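import Summits.CriticalPhenomena.PercolationContinuityZ3.Theorems.PercNearOneGluingNoHeavyQuantSingleMidCriterion
import HarnessLib

/-!
# QUANT lane R8, T-DEC: THE SINGLE-MID CRITERION FOR A LAW GIVEN BY TERMS (`LawDec.decAtT_of_singleMid_terms`) — the cell interface of the
# pooled residue of `LightSliceCore` (census-2 g59)

builds on p205010 (kernel theorem, internal audit signed; external expert review pending)

Support file (`--supports stmt-CriticalPhenomena-4575`), QUANT lane seat prim-quant-census-2 (gen 59), rung R8 of
`run/shared/lean/prim/quant/LADDER.md`.  Memo `run/shared/lean/prim/quant/prim-quant-census-2-g59/ASSEMBLY-G59.md` §3–§4.  Theorems only,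
standard axioms, no sorries, no definitions.

WHY.  The light slice of the residue classes (`LightSliceLowCross`, `LightSliceWide`) is an EIGHT-TERM law `q ↦ Σ_i c_i·[q = pos_i]` (the two
shifts of the four-term atom), whose terms may land on coinciding positions.  `…QuantSingleMidCriterion` (`decAtT_of_singleMid`) is stated for a
law as a function of the position; this file restates it for a law given by TERMS, so that a cell proof only evaluates finitely many `if`s at the
term positions: with a designated mid `h₀` (`h₀ ≤ j`, `h₀ ≤ M`, `T ≤ 2h₀`), a term is LOW if `pos ≤ j ∧ 2·pos < T`, GIANT if `j + 1 ≤ pos`, AT THE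
MID if `pos = h₀` (other terms are unused absorbers), a low term is COMPATIBLE if `T < pos + h₀`; then
* **`LawDec.decAtT_of_singleMid_terms`**: `u·(incompatible low mass) ≤ giant mass` and, for all `θ ≥ 0`,
  `Σ_{low terms} c_i·(compatible ? min(usage(pos_i, h₀), θ) : θ) ≤ (mass at the mid) + θ·(giant mass)/u` ⟹ `DECAtT x T j M (Σ_i c_i δ_{pos_i})`.
Exact census (census-2 g59, `code/resid_knap.py`, M ≤ 6, 7 floors; kit j163808 M ≤ 8): EVERY residue instance of the `LightSliceCore` binder
(2 138 / 2 138: Type I low cross 1 597, crossed Type II low cross 337, wide 204) is certified by this criterion with the head cell of the light row as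
the mid (`p + h′`), usage order `M2 < M1 < P1/P2` — census-1 g22's "PH-greedy".
Tools: `sum_range_mul_terms`, `sum_Ico_terms` (swapping a sum over positions with the sum over terms).

[this work]; LP duality [cite: Schrijver1986, Cor 7.1f (p. 90)] via `…QuantLawDecStrongDuality`.  The gluing rows served
[cite: KozmaNitzan2024, Conjecture 3 (p. 15)]; product measure [cite: Grimmett1999, §1.3 p. 10].
-/

noncomputable section

namespace Summit.CriticalPhenomena.PercolationContinuityZ3.Theorems

namespace Quant

open Finset

namespace LawDec

variable {ι : Type} [Fintype ι]

/-- swapping a weighted sum over the positions `< N` with the sum over the terms. [this work] -/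
theorem sum_range_mul_terms (N : ℕ) (c : ι → ℝ) (pos : ι → ℕ) (Φ : ℕ → ℝ) :
    ∑ q ∈ Finset.range N, Φ q * (∑ i, c i * (if q = pos i then (1 : ℝ) else 0))
      = ∑ i, (if pos i < N then c i * Φ (pos i) else 0) := by
  classical
  simp_rw [Finset.mul_sum]
  rw [Finset.sum_comm]
  refine Finset.sum_congr rfl fun i _ => ?_
  have e : ∀ q, Φ q * (c i * (if q = pos i then (1 : ℝ) else 0)) = (if q = pos i then c i * Φ (pos i) else 0) := by
    intro q
    split_ifs with hq
    · rw [hq]; ring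
    · ring
  simp_rw [e]
  rw [Finset.sum_ite_eq' (Finset.range N) (pos i)]
  simp only [Finset.mem_range]

/-- the mass of the terms at positions in `[a, b)`. [this work] -/
theorem sum_Ico_terms (a b : ℕ) (c : ι → ℝ) (pos : ι → ℕ) :
    ∑ q ∈ Finset.Ico a b, (∑ i, c i * (if q = pos i then (1 : ℝ) else 0)) = ∑ i, (if a ≤ pos i ∧ pos i < b then c i else 0) := by
  classical
  rw [Finset.sum_comm]
  refine Finset.sum_congr rfl fun i _ => ?_
  have e : ∀ q, c i * (if q = pos i then (1 : ℝ) else 0) = (if q = pos i then c i else 0) := by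
    intro q; split_ifs <;> ring
  simp_rw [e]
  rw [Finset.sum_ite_eq' (Finset.Ico a b) (pos i)]
  simp only [Finset.mem_Ico]

/-- **THE SINGLE-MID CRITERION FOR A LAW GIVEN BY TERMS.**  Floor `0 < x < 1`, target `T`, layer `j`, top `M`; a law `Σ_i c_i δ_{pos_i}` with
`c_i ≥ 0`, `Σ c_i = 1`, `pos_i ≤ M`; a mid `h₀ ≤ j`, `h₀ ≤ M`, `T ≤ 2h₀`.  If `u·Σ_{low incompatible terms} c_i ≤ Σ_{giant terms} c_i` and for
every `θ ≥ 0` the knapsack inequality `Σ_{low terms} c_i·(T < pos_i + h₀ ? min(usage(pos_i,h₀), θ) : θ) ≤ Σ_{pos_i = h₀} c_i + θ·((1−x)/x)·Σ_{giant} c_i`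
holds, the law is `DECAtT x T j M`. [this work] -/
theorem decAtT_of_singleMid_terms (x T : ℝ) (j M h₀ : ℕ) (c : ι → ℝ) (pos : ι → ℕ) (hx0 : 0 < x) (hx1 : x < 1)
    (hc0 : ∀ i, 0 ≤ c i) (hc1 : ∑ i, c i = 1) (hpos : ∀ i, pos i ≤ M)
    (hh₀j : h₀ ≤ j) (hh₀M : h₀ ≤ M) (hh₀T : T ≤ 2 * (h₀ : ℝ))
    (hinc : x / (1 - x) * ∑ i, (if pos i ≤ j ∧ 2 * (pos i : ℝ) < T ∧ ¬ (T < (pos i : ℝ) + h₀) then c i else 0)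
      ≤ ∑ i, (if j + 1 ≤ pos i then c i else 0))
    (hknap : ∀ θ : ℝ, 0 ≤ θ →
      ∑ i, (if pos i ≤ j ∧ 2 * (pos i : ℝ) < T then
              c i * (if T < (pos i : ℝ) + h₀ then min (usage x T j (pos i) h₀) θ else θ) else 0)
        ≤ (∑ i, (if pos i = h₀ then c i else 0)) + θ * ((1 - x) / x) * ∑ i, (if j + 1 ≤ pos i then c i else 0)) :
    DECAtT x T j M (fun q => ∑ i, c i * (if q = pos i then (1 : ℝ) else 0)) := by
  classical
  set μ : ℕ → ℝ := fun q => ∑ i, c i * (if q = pos i then (1 : ℝ) else 0) with hμ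
  have hμ0 : ∀ q, 0 ≤ μ q := fun q => Finset.sum_nonneg fun i _ => mul_nonneg (hc0 i) (by split_ifs <;> norm_num)
  have hμM : ∀ q, M < q → μ q = 0 := by
    intro q hq
    refine Finset.sum_eq_zero fun i _ => ?_
    rw [if_neg (by have := hpos i; omega), mul_zero]
  -- total mass
  have hμ1 : ∑ q ∈ Finset.range (M + 1), μ q = 1 := by
    have := sum_range_mul_terms (M + 1) c pos (fun _ => (1 : ℝ))
    simp only [one_mul, mul_one] at this
    rw [this, ← hc1]
    refine Finset.sum_congr rfl fun i _ => ?_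
    rw [if_pos (by have := hpos i; omega)]
  -- giant mass
  have hG : ∑ q ∈ Finset.Ico (j + 1) (M + 1), μ q = ∑ i, (if j + 1 ≤ pos i then c i else 0) := by
    rw [sum_Ico_terms (j + 1) (M + 1) c pos]
    refine Finset.sum_congr rfl fun i _ => ?_
    by_cases h1 : j + 1 ≤ pos i
    · rw [if_pos ⟨h1, by have := hpos i; omega⟩, if_pos h1]
    · rw [if_neg (by push Not; intro h; exact absurd h h1), if_neg h1]
  -- mass at the mid
  have hmid : μ h₀ = ∑ i, (if pos i = h₀ then c i else 0) := by
    refine Finset.sum_congr rfl fun i _ => ?_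
    by_cases h1 : pos i = h₀
    · rw [if_pos h1.symm, if_pos h1, mul_one]
    · rw [if_neg (Ne.symm h1), if_neg h1, mul_zero]
  refine decAtT_of_singleMid x T j M h₀ μ hx0 hx1 hμ0 hμM hμ1 hh₀j hh₀M hh₀T ?_ fun θ hθ => ?_
  · -- incompatible low mass
    have e : ∑ l ∈ Finset.range (j + 1), (if 2 * (l : ℝ) < T ∧ ¬ (T < (l : ℝ) + h₀) then μ l else 0)
        = ∑ l ∈ Finset.range (j + 1), (if 2 * (l : ℝ) < T ∧ ¬ (T < (l : ℝ) + h₀) then (1 : ℝ) else 0) * μ l := by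
      refine Finset.sum_congr rfl fun l _ => ?_
      split_ifs <;> simp
    rw [e, sum_range_mul_terms (j + 1) c pos, hG]
    refine le_trans (le_of_eq ?_) hinc
    congr 1
    refine Finset.sum_congr rfl fun i _ => ?_
    by_cases h1 : pos i ≤ j
    · rw [if_pos (by omega)]
      by_cases h2 : 2 * (pos i : ℝ) < T ∧ ¬ (T < (pos i : ℝ) + h₀)
      · rw [if_pos h2, if_pos (show pos i ≤ j ∧ 2 * (pos i : ℝ) < T ∧ ¬ (T < (pos i : ℝ) + h₀) from ⟨h1, h2⟩), mul_one]
      · rw [if_neg h2, if_neg (show ¬ (pos i ≤ j ∧ 2 * (pos i : ℝ) < T ∧ ¬ (T < (pos i : ℝ) + h₀)) from fun h => h2 h.2),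
          mul_zero]
    · rw [if_neg (by omega), if_neg (by push Not; intro h; exact absurd h h1)]
  · -- the knapsack inequality
    have e : ∑ l ∈ Finset.range (j + 1),
          (if 2 * (l : ℝ) < T then (if T < (l : ℝ) + h₀ then μ l * min (usage x T j l h₀) θ else θ * μ l) else 0)
        = ∑ l ∈ Finset.range (j + 1),
          (if 2 * (l : ℝ) < T then (if T < (l : ℝ) + h₀ then min (usage x T j l h₀) θ else θ) else 0) * μ l := by
      refine Finset.sum_congr rfl fun l _ => ?_
      split_ifs <;> ring
    rw [e, sum_range_mul_terms (j + 1) c pos, hG, hmid]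
    refine le_trans (le_of_eq ?_) (hknap θ hθ)
    refine Finset.sum_congr rfl fun i _ => ?_
    by_cases h1 : pos i ≤ j
    · rw [if_pos (by omega)]
      by_cases h2 : 2 * (pos i : ℝ) < T
      · rw [if_pos h2, if_pos (show pos i ≤ j ∧ 2 * (pos i : ℝ) < T from ⟨h1, h2⟩), mul_comm]
      · rw [if_neg h2, if_neg (show ¬ (pos i ≤ j ∧ 2 * (pos i : ℝ) < T) from fun h => h2 h.2), mul_zero]
    · rw [if_neg (by omega), if_neg (by push Not; intro h; exact absurd h h1)]

end LawDec

end Quant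

end Summit.CriticalPhenomena.PercolationContinuityZ3.Theorems
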